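import Mathlib
import Summits.CriticalPhenomena.CardyFormulaZ2.Theorems.CardyMagicRigidityPositiveConeJointDefs
import Summits.CriticalPhenomena.CardyFormulaZ2.Theorems.CardyMagicRigidityNestingRigidityTameRigidityDouble
import Literature.Probability.RandomPlanarGeometry.LoopConfigurations
import HarnessLib

/-!
# `tame_rigidity` is false, IV: two tame loops with the same winding function that differ

Crux `Summit.CriticalPhenomena.CardyFormulaZ2.Theses.CardyMagicRigidity.NestingRigidity`
(stmt-CriticalPhenomena-4835), line `positive-cone-weight-doubling`.  The registered helper

  `tame_rigidity : ∀ u v : UnbasedLoop ℂ, Tame u → Tame v → (∀ z, u.wind z = v.wind z) → u = v`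

(`Tame` of `Theorems/CardyMagicRigidityPositiveConeJointDefs.lean`: single-signed degree one, trace = frontier of
the winding interior, solid, at most double points) is FALSE: `not_tame_rigidity`, from the witness
`exists_tame_wind_eq_ne` (anchor) — two TAME unbased loops `u ≠ v` with `W(u, ·) = W(v, ·)` everywhere, at
oriented unbased distance `dist u v ≥ 1/2`.

THE WITNESS ("two-mouth lake"; bricks `…TameRigidityArcs` p131776, `…TameRigidityGeometry` p131987,
`…TameRigidityDouble` p132396).  `u` is the loop `L = U·D·d·b·a·c` (big circle `|z| = 2` anticlockwise from `2`,
then the lower half `d` of the right lake boundary `|z − 1| = 1`, the left lake boundary `|z + 1| = 1` clockwise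
from `0` (`b`, `a`), the upper half `c` of the right one), and `v` is its rotation `−L = D·U·a·c·d·b` by `π`.
Both are Eulerian circuits of the oriented 1-cycle `∂B(0,2) − ∂B(−1,1) − ∂B(1,1)`, so both have trace the three
circles and `W = 𝟙[G]`, `G = {|z| < 2, |z ± 1| > 1}` (`§2`: `W(−L, z) = W(L, −z)` and `G = −G`); both are tame
(`§1`, from the bricks); each of the tangency points `−2, 0, 2` is a double point of both.  They DIFFER: `L`
passes the single points `2i, −2i, −1+i` in this cyclic order, `−L` in the opposite one, and an
orientation-preserving `ε`-matching of the two parametrised circles (`ε < 1/2`) would carry three cyclically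
ordered times of `L` at these points to three cyclically ordered times of `−L` within `ε` of them, which the
time windows of `−L` near these points (`§3`) forbid (`§4`–`§5`, `half_le_dist`).

REMARK (mechanism, not formalised here).  At a double point of a loop with `W ∈ {0, 1}` the four germs alternate
in/out and both pairings of in-germs with out-germs are orientation-consistent.  If two double points `p, q`
have CROSSING chords — visits in the cyclic order `p … q … p … q`, loop `= pXqYpZqW` — then the re-routed word
`pZqYpXqW` is again a closed curve with the same trace, the same visit multiplicities and the same oriented
1-cycle, hence the SAME winding function, and it is tame when the original is; generically it is a different
unbased loop (here: `p = 2`, `q = −2` … in fact all three contacts of the two-mouth lake cross pairwise, and the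
three Eulerian circuits are `L`, `−L` and the `8`-shaped `U·a·b·D·d·c`).  Neck-type reading: the routing at a
pinch point records WHICH of the two touching sides (the `W = 1` side or the `W = 0` side) is connected through
the pinch, and `(trace, W)` cannot see it.  For SLE₆/CLE₆-type loops crossing chord pairs are expected almost
surely (after closing a bubble at `p` the curve re-touches the arc it has just traced), so no generic extra
hypothesis satisfied by the lattice limits restores `W`-rigidity of single loops: everything a nesting
transform sees is a function of `(trace, W, type)`, which does not determine the unbased loop.
-/

noncomputable section

open Set Metric Complex Filter Topology
open scoped Real

namespace Summit.CriticalPhenomena.CardyFormulaZ2.Cruxes.NestingRigidity.PositiveConeWeightDoubling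

open Literature.Probability.RandomPlanarGeometry
open NeedleLoops (isLoop_ofPath)

namespace TwoMouth

/-! ## §1 From trace, winding function and double points to `Tame` -/

/-- A Mathlib loop with trace the three circles, winding function `𝟙[G]` and at most double points defines a
TAME unbased loop (`frontier_interior`, `interior_union` of `…TameRigidityGeometry`). -/
theorem tame_of_spec {x : ℂ} (γ : Path x x)
    (hr : Set.range γ = sphere (0 : ℂ) 2 ∪ sphere (-1) 1 ∪ sphere 1 1)
    (hw : ∀ z, (Curve.ofPath γ).wind z = if ‖z‖ < 2 ∧ 1 < ‖z + 1‖ ∧ 1 < ‖z - 1‖ then 1 else 0)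
    (h2 : ∀ t₁ t₂ t₃ : unitInterval, t₁ < 1 → t₂ < 1 → t₃ < 1 → γ t₁ = γ t₂ → γ t₂ = γ t₃ →
      t₁ = t₂ ∨ t₂ = t₃ ∨ t₁ = t₃) :
    Tame (UnbasedLoop.mk (BasedLoop.mk (CurveClass.mk (Curve.ofPath γ))
      (CurveClass.isLoop_mk.2 (isLoop_ofPath γ)))) := by
  set u := UnbasedLoop.mk (BasedLoop.mk (CurveClass.mk (Curve.ofPath γ))
      (CurveClass.isLoop_mk.2 (isLoop_ofPath γ))) with hu
  have hwu : ∀ z, u.wind z = (Curve.ofPath γ).wind z := fun z ↦ rfl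
  have hru : u.range = Set.range γ := rfl
  have hint : {z | u.wind z ≠ 0} = {z : ℂ | ‖z‖ < 2 ∧ 1 < ‖z + 1‖ ∧ 1 < ‖z - 1‖} := by
    ext z
    rw [mem_setOf_eq, hwu, hw]
    split_ifs with h
    · simp only [ne_eq, one_ne_zero, not_false_eq_true, true_iff]; exact h
    · simp only [ne_eq, not_true_eq_false, false_iff]; exact h
  refine ⟨Or.inl fun z ↦ ?_, ?_, ?_, ⟨Curve.ofPath γ, isLoop_ofPath γ, rfl, h2⟩⟩
  · rw [hwu, hw]; split_ifs <;> simp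
  · rw [hint, frontier_interior, hru, hr]
  · rw [hint, hru, hr, interior_union]

/-! ## §2 The rotated loop `−L` -/

/-- The trace of the rotated loop is again the three circles. -/
theorem range_neg {x : ℂ} (γ : Path x x) (hr : Set.range γ = sphere (0 : ℂ) 2 ∪ sphere (-1) 1 ∪ sphere 1 1) :
    Set.range (γ.map continuous_neg) = sphere (0 : ℂ) 2 ∪ sphere (-1) 1 ∪ sphere 1 1 := by
  ext w
  have key : w ∈ Set.range (γ.map continuous_neg) ↔ -w ∈ Set.range γ := by
    rw [Path.map_coe, Set.range_comp]
    constructor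
    · rintro ⟨y, hy, rfl⟩; rwa [neg_neg]
    · intro h; exact ⟨-w, h, neg_neg w⟩
  rw [key, hr, mem_trace_iff, mem_trace_iff, norm_neg, ← sub_eq_neg_add, norm_sub_rev, ← neg_add', norm_neg]
  tauto

/-- The winding function of the rotated loop: `W(−γ, z) = W(γ, −z)`, and `𝟙[G]` is even. -/
theorem wind_neg {x : ℂ} (γ : Path x x)
    (hw : ∀ z, (Curve.ofPath γ).wind z = if ‖z‖ < 2 ∧ 1 < ‖z + 1‖ ∧ 1 < ‖z - 1‖ then 1 else 0) (z : ℂ) :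
    (Curve.ofPath (γ.map continuous_neg)).wind z = if ‖z‖ < 2 ∧ 1 < ‖z + 1‖ ∧ 1 < ‖z - 1‖ then 1 else 0 := by
  have e : Curve.ofPath (γ.map continuous_neg) = (Curve.ofPath γ).map ⟨fun w ↦ -1 * w + 0, by fun_prop⟩ := by
    ext t
    simp [Curve.map_apply, Curve.ofPath_apply, Path.map_coe]
  have key := Curve.wind_map_affine (Curve.ofPath γ) (a := -1) (by norm_num) 0 (-z)
  rw [← e, show (-1 : ℂ) * -z + 0 = z by ring] at key
  rw [key, hw, norm_neg, ← sub_eq_neg_add, norm_sub_rev, ← neg_add', norm_neg]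
  by_cases h : ‖z‖ < 2 ∧ 1 < ‖z + 1‖ ∧ 1 < ‖z - 1‖
  · rw [if_pos h, if_pos ⟨h.1, h.2.2, h.2.1⟩]
  · rw [if_neg h, if_neg (fun h' ↦ h ⟨h'.1, h'.2.2, h'.2.1⟩)]

/-- The rotated loop has at most double points when the loop has. -/
theorem atMostDouble_neg {x : ℂ} (γ : Path x x)
    (h2 : ∀ t₁ t₂ t₃ : unitInterval, t₁ < 1 → t₂ < 1 → t₃ < 1 → γ t₁ = γ t₂ → γ t₂ = γ t₃ →
      t₁ = t₂ ∨ t₂ = t₃ ∨ t₁ = t₃) (t₁ t₂ t₃ : unitInterval) (h₁ : t₁ < 1) (h₂' : t₂ < 1) (h₃ : t₃ < 1)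
    (e₁ : (γ.map continuous_neg) t₁ = (γ.map continuous_neg) t₂)
    (e₂ : (γ.map continuous_neg) t₂ = (γ.map continuous_neg) t₃) : t₁ = t₂ ∨ t₂ = t₃ ∨ t₁ = t₃ := by
  simp only [Path.map_coe, Function.comp_apply, neg_inj] at e₁ e₂
  exact h2 t₁ t₂ t₃ h₁ h₂' h₃ e₁ e₂

/-! ## §3 Three marked points of `L`, and the time windows of `L` near three points -/

section Loop

variable {U : Path (2 : ℂ) (-2)} {D : Path (-2 : ℂ) 2} {a : Path (-2 : ℂ) 0} {b : Path (0 : ℂ) (-2)}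
  {c : Path (0 : ℂ) 2} {d : Path (2 : ℂ) 0}

/-- `L(⅛) = 2i`, `L(⅜) = −2i`, `L(13/16) = −1 + i`, at increasing times. -/
theorem marked_points (hU : ∀ t, U t = circleMap 0 2 (0 + (π - 0) * t)) (hD : ∀ t, D t = circleMap 0 2 (π + (2 * π - π) * t)) (ha : ∀ t, a t = circleMap (-1) 1 (π + (0 - π) * t)) : ∃ tX tY tZ : unitInterval, tX < tY ∧ tY < tZ ∧ 0 < tX ∧ tZ < 1 ∧
    ((U.trans D).trans ((d.trans b).trans (a.trans c))) tX = 2 * I ∧ ((U.trans D).trans ((d.trans b).trans (a.trans c))) tY = -(2 * I) ∧ ((U.trans D).trans ((d.trans b).trans (a.trans c))) tZ = -1 + I := by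
  refine ⟨⟨1 / 8, by norm_num, by norm_num⟩, ⟨3 / 8, by norm_num, by norm_num⟩,
    ⟨13 / 16, by norm_num, by norm_num⟩, by norm_num [Subtype.mk_lt_mk], by norm_num [Subtype.mk_lt_mk],
    by norm_num [← Subtype.coe_lt_coe], by norm_num [← Subtype.coe_lt_coe], ?_, ?_, ?_⟩
  · rw [loop_apply_big hU hD (by norm_num), show 4 * π * ((1 / 8 : ℝ)) = π / 2 by ring, circleMap_pi_div_two]
    push_cast; ring
  · rw [loop_apply_big hU hD (by norm_num), show 4 * π * ((3 / 8 : ℝ)) = -π / 2 + 2 * π by ring,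
      periodic_circleMap, circleMap_neg_pi_div_two]
    push_cast; ring
  · rw [loop_apply_a ha (by norm_num) (by norm_num), show π - π * (8 * (13 / 16 : ℝ) - 6) = π / 2 by ring,
      circleMap_pi_div_two]
    push_cast; ring

/-- Imaginary part of a point of a circle. -/
theorem circleMap_im (c : ℂ) (R θ : ℝ) : (circleMap c R θ).im = c.im + R * Real.sin θ := by
  rw [← sub_add_cancel (circleMap c R θ) c, circleMap_sub_center, add_im, circleMap_zero_im, add_comm]

/-- On the lake boundaries (`t > ½`) the imaginary part of `L t` is in `[−1, 1]`. -/
theorem abs_im_loop_le (ha : ∀ t, a t = circleMap (-1) 1 (π + (0 - π) * t)) (hb : ∀ t, b t = circleMap (-1) 1 (0 + (-π - 0) * t)) (hc : ∀ t, c t = circleMap 1 1 (π + (0 - π) * t)) (hd : ∀ t, d t = circleMap 1 1 (0 + (-π - 0) * t)) {t : unitInterval} (ht : 1 / 2 < (t : ℝ)) : |(((U.trans D).trans ((d.trans b).trans (a.trans c))) t).im| ≤ 1 := by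
  rcases slot_cases t with h | ⟨h₁, h₂⟩ | (⟨h₁, h₂⟩ | h₁)
  · exact absurd h (not_le.2 ht)
  · by_cases h₃ : (t : ℝ) ≤ 3 / 4
    · rw [loop_apply_b hb h₁ h₃, circleMap_im]; simpa using Real.abs_sin_le_one _
    · rw [loop_apply_a ha (not_le.1 h₃) h₂, circleMap_im]; simpa using Real.abs_sin_le_one _
  · rw [loop_apply_d hd h₁ h₂, circleMap_im]; simpa using Real.abs_sin_le_one _
  · rw [loop_apply_c hc h₁, circleMap_im]; simpa using Real.abs_sin_le_one _

/-- **Window at `−2i`**: `dist (L s, −2i) < 1/2` forces `s ∈ (¼, ½)`. -/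
theorem window_neg_two_I (hU : ∀ t, U t = circleMap 0 2 (0 + (π - 0) * t)) (hD : ∀ t, D t = circleMap 0 2 (π + (2 * π - π) * t)) (ha : ∀ t, a t = circleMap (-1) 1 (π + (0 - π) * t)) (hb : ∀ t, b t = circleMap (-1) 1 (0 + (-π - 0) * t)) (hc : ∀ t, c t = circleMap 1 1 (π + (0 - π) * t)) (hd : ∀ t, d t = circleMap 1 1 (0 + (-π - 0) * t)) {s : unitInterval}
    (h : dist (((U.trans D).trans ((d.trans b).trans (a.trans c))) s) (-(2 * I)) < 1 / 2) : 1 / 4 < (s : ℝ) ∧ (s : ℝ) < 1 / 2 := by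
  rw [dist_eq_norm] at h
  have him : |(((U.trans D).trans ((d.trans b).trans (a.trans c))) s).im + 2| < 1 / 2 := lt_of_le_of_lt (by simpa using abs_im_le_norm (((U.trans D).trans ((d.trans b).trans (a.trans c))) s - -(2 * I))) h
  by_cases hs : (s : ℝ) ≤ 1 / 2
  · rw [loop_apply_big hU hD hs, circleMap_im, zero_im, zero_add] at him
    have hsin : Real.sin (4 * π * s) < 0 := by
      have := (abs_lt.1 him).2; linarith
    constructor
    · by_contra h'
      have := Real.sin_nonneg_of_nonneg_of_le_pi (x := 4 * π * s) (by nlinarith [Real.pi_pos, s.2.1])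
        (by nlinarith [Real.pi_pos, not_lt.1 h'])
      linarith
    · refine lt_of_le_of_ne hs fun e ↦ ?_
      rw [e, show 4 * π * (1 / 2 : ℝ) = 2 * π by ring, Real.sin_two_pi] at hsin
      exact lt_irrefl 0 hsin
  · have := abs_im_loop_le ha hb hc hd (U := U) (D := D) (not_le.1 hs)
    have h1 := (abs_le.1 this).1
    have h2 := (abs_lt.1 him).2
    exfalso; linarith

/-- **Window at `2i`**: `dist (L s, 2i) < 1/2` forces `s < ¼`. -/
theorem window_two_I (hU : ∀ t, U t = circleMap 0 2 (0 + (π - 0) * t)) (hD : ∀ t, D t = circleMap 0 2 (π + (2 * π - π) * t)) (ha : ∀ t, a t = circleMap (-1) 1 (π + (0 - π) * t)) (hb : ∀ t, b t = circleMap (-1) 1 (0 + (-π - 0) * t)) (hc : ∀ t, c t = circleMap 1 1 (π + (0 - π) * t)) (hd : ∀ t, d t = circleMap 1 1 (0 + (-π - 0) * t)) {s : unitInterval}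
    (h : dist (((U.trans D).trans ((d.trans b).trans (a.trans c))) s) (2 * I) < 1 / 2) : (s : ℝ) < 1 / 4 := by
  rw [dist_eq_norm] at h
  have him : |(((U.trans D).trans ((d.trans b).trans (a.trans c))) s).im - 2| < 1 / 2 := lt_of_le_of_lt (by simpa using abs_im_le_norm (((U.trans D).trans ((d.trans b).trans (a.trans c))) s - 2 * I)) h
  by_cases hs : (s : ℝ) ≤ 1 / 2
  · rw [loop_apply_big hU hD hs, circleMap_im, zero_im, zero_add] at him
    have hsin : 0 < Real.sin (4 * π * s) := by
      have := (abs_lt.1 him).1; linarith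
    by_contra h'
    have := Real.sin_nonpos_of_nonpos_of_neg_pi_le (x := 4 * π * s - 2 * π) (by nlinarith [Real.pi_pos])
      (by nlinarith [Real.pi_pos, not_lt.1 h'])
    rw [Real.sin_sub_two_pi] at this
    linarith
  · have := abs_im_loop_le ha hb hc hd (U := U) (D := D) (not_le.1 hs)
    have h1 := (abs_le.1 this).2
    have h2 := (abs_lt.1 him).1
    exfalso; linarith

/-- **Window at `1 − i`**: `dist (L s, 1 − i) < 1/2` forces `s ∈ (½, ⅝]`. -/
theorem window_one_sub_I (hU : ∀ t, U t = circleMap 0 2 (0 + (π - 0) * t)) (hD : ∀ t, D t = circleMap 0 2 (π + (2 * π - π) * t)) (ha : ∀ t, a t = circleMap (-1) 1 (π + (0 - π) * t)) (hb : ∀ t, b t = circleMap (-1) 1 (0 + (-π - 0) * t)) (hc : ∀ t, c t = circleMap 1 1 (π + (0 - π) * t)) {s : unitInterval}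
    (h : dist (((U.trans D).trans ((d.trans b).trans (a.trans c))) s) (1 - I) < 1 / 2) : 1 / 2 < (s : ℝ) ∧ (s : ℝ) ≤ 5 / 8 := by
  rw [dist_eq_norm] at h
  have him : |(((U.trans D).trans ((d.trans b).trans (a.trans c))) s).im + 1| < 1 / 2 := lt_of_le_of_lt (by simpa using abs_im_le_norm (((U.trans D).trans ((d.trans b).trans (a.trans c))) s - (1 - I))) h
  rcases slot_cases s with hs | ⟨h₁, h₂⟩ | (⟨h₁, h₂⟩ | h₁)
  · exfalso
    by_cases hs' : (s : ℝ) ≤ 1 / 4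
    · -- upper big semicircle: `im ≥ 0`
      rw [loop_apply_big hU hD hs, circleMap_im, zero_im, zero_add] at him
      have := Real.sin_nonneg_of_nonneg_of_le_pi (x := 4 * π * s) (by nlinarith [Real.pi_pos, s.2.1])
        (by nlinarith [Real.pi_pos])
      have h2 := (abs_lt.1 him).2
      linarith
    · -- lower big semicircle: `|L s| = 2` while `|1 - i| < 3/2`
      have hn : ‖((U.trans D).trans ((d.trans b).trans (a.trans c))) s‖ = 2 := norm_loop_big (a := a) (b := b) (c := c) (d := d) hU hD hs
      have h1I : ‖(1 : ℂ) - I‖ < 3 / 2 := by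
        have : ‖(1 : ℂ) - I‖ ^ 2 = 2 := by
          rw [Literature.Probability.Process.norm_sq_eq_re_sq_add_im_sq]; simp; norm_num
        nlinarith [norm_nonneg ((1 : ℂ) - I)]
      have := norm_sub_norm_le (((U.trans D).trans ((d.trans b).trans (a.trans c))) s) (1 - I)
      rw [hn] at this
      linarith
  · exfalso
    -- left lake boundary: `|L s + 1| = 1` while `|2 - i| > 2`
    have hn : ‖((U.trans D).trans ((d.trans b).trans (a.trans c))) s + 1‖ = 1 := norm_loop_left (U := U) (D := D) (c := c) (d := d) ha hb h₁ h₂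
    have h2I : (2 : ℝ) < ‖(2 : ℂ) - I‖ := by
      have : ‖(2 : ℂ) - I‖ ^ 2 = 5 := by
        rw [Literature.Probability.Process.norm_sq_eq_re_sq_add_im_sq]; simp; norm_num
      nlinarith [norm_nonneg ((2 : ℂ) - I)]
    have := norm_sub_norm_le ((2 : ℂ) - I) (((U.trans D).trans ((d.trans b).trans (a.trans c))) s + 1)
    rw [hn, show (2 : ℂ) - I - (((U.trans D).trans ((d.trans b).trans (a.trans c))) s + 1) = -(((U.trans D).trans ((d.trans b).trans (a.trans c))) s - (1 - I)) by ring, norm_neg] at this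
    linarith
  · exact ⟨h₁, h₂⟩
  · exfalso
    -- upper right semicircle: `im ≥ 0`
    rw [loop_apply_c hc h₁, circleMap_im, one_im, zero_add, one_mul] at him
    have := Real.sin_nonneg_of_nonneg_of_le_pi (x := π - π * (8 * s - 7)) (by nlinarith [Real.pi_pos, s.2.2])
      (by nlinarith [Real.pi_pos])
    have h2 := (abs_lt.1 him).2
    linarith

/-! ## §4 Cyclic order is preserved by a change of base point -/

/-- Shifting three increasing times of `[0, 1)` around the circle keeps them cyclically increasing. -/
theorem cyclic_fract {x y z : ℝ} (hx : 0 ≤ x) (hxy : x < y) (hyz : y < z) (hz : z < 1) (b : ℝ) :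
    (Int.fract (x + b) < Int.fract (y + b) ∧ Int.fract (y + b) < Int.fract (z + b)) ∨
    (Int.fract (y + b) < Int.fract (z + b) ∧ Int.fract (z + b) < Int.fract (x + b)) ∨
    (Int.fract (z + b) < Int.fract (x + b) ∧ Int.fract (x + b) < Int.fract (y + b)) := by
  -- reduce to `b ∈ [0, 1)`
  have key : ∀ w : ℝ, Int.fract (w + b) = Int.fract (w + Int.fract b) := fun w ↦ by
    conv_lhs => rw [← Int.fract_add_floor b, ← add_assoc, Int.fract_add_intCast]
  rw [key x, key y, key z]
  have hb0 := Int.fract_nonneg b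
  have hb1 := Int.fract_lt_one b
  set c := Int.fract b
  have lo : ∀ w : ℝ, 0 ≤ w → w + c < 1 → Int.fract (w + c) = w + c := fun w h0 h1 ↦
    Int.fract_eq_self.2 ⟨by linarith, h1⟩
  have hi : ∀ w : ℝ, w < 1 → 1 ≤ w + c → Int.fract (w + c) = w + c - 1 := fun w h0 h1 ↦
    Int.fract_eq_iff.2 ⟨by linarith, by linarith, 1, by push_cast; ring⟩
  by_cases hz1 : z + c < 1
  · rw [lo x hx (by linarith), lo y (by linarith) (by linarith), lo z (by linarith) hz1]
    exact Or.inl ⟨by linarith, by linarith⟩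
  by_cases hy1 : y + c < 1
  · rw [lo x hx (by linarith), lo y (by linarith) hy1, hi z hz (not_lt.1 hz1)]
    exact Or.inr (Or.inr ⟨by linarith, by linarith⟩)
  by_cases hx1 : x + c < 1
  · rw [lo x hx hx1, hi y (by linarith) (not_lt.1 hy1), hi z hz (not_lt.1 hz1)]
    exact Or.inr (Or.inl ⟨by linarith, by linarith⟩)
  · rw [hi x (by linarith) (not_lt.1 hx1), hi y (by linarith) (not_lt.1 hy1), hi z hz (not_lt.1 hz1)]
    exact Or.inl ⟨by linarith, by linarith⟩

/-! ## §5 `L` and `−L` are at oriented unbased distance `≥ 1/2` -/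

/-- **`dist (L, −L) ≥ 1/2`** for the unbased loops of `L` and of its rotation by `π`: an orientation-preserving
`ε`-matching with `ε < 1/2` (a base point `b₀` and an increasing reparametrisation `φ`, from `loopDist < 1/2`)
would send the times `⅛ < ⅜ < 13/16` (where `L = 2i, −2i, −1+i`) to three CYCLICALLY increasing times at which
`−L` is within `1/2` of `2i, −2i, −1+i`, i.e. `L` within `1/2` of `−2i, 2i, 1−i`; the windows `(¼,½)`, `[0,¼)`,
`(½,⅝]` of these events are in the opposite cyclic order. -/
theorem half_le_dist (hU : ∀ t, U t = circleMap 0 2 (0 + (π - 0) * t)) (hD : ∀ t, D t = circleMap 0 2 (π + (2 * π - π) * t)) (ha : ∀ t, a t = circleMap (-1) 1 (π + (0 - π) * t)) (hb : ∀ t, b t = circleMap (-1) 1 (0 + (-π - 0) * t)) (hc : ∀ t, c t = circleMap 1 1 (π + (0 - π) * t)) (hd : ∀ t, d t = circleMap 1 1 (0 + (-π - 0) * t)) :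
    1 / 2 ≤ dist (UnbasedLoop.mk (BasedLoop.mk (CurveClass.mk (Curve.ofPath ((U.trans D).trans ((d.trans b).trans (a.trans c)))))
        (CurveClass.isLoop_mk.2 (isLoop_ofPath ((U.trans D).trans ((d.trans b).trans (a.trans c)))))))
      (UnbasedLoop.mk (BasedLoop.mk (CurveClass.mk (Curve.ofPath (((U.trans D).trans ((d.trans b).trans (a.trans c))).map continuous_neg)))
        (CurveClass.isLoop_mk.2 (isLoop_ofPath (((U.trans D).trans ((d.trans b).trans (a.trans c))).map continuous_neg))))) := by
  set α := Curve.ofPath ((U.trans D).trans ((d.trans b).trans (a.trans c))) with hα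
  set β := Curve.ofPath (((U.trans D).trans ((d.trans b).trans (a.trans c))).map continuous_neg) with hβ
  have hβl : β.IsLoop := isLoop_ofPath _
  change 1 / 2 ≤ Curve.loopDist α β
  by_contra hlt
  rw [not_le] at hlt
  obtain ⟨b₀, hb₀⟩ := exists_lt_of_ciInf_lt hlt
  obtain ⟨φ, hφ⟩ := Curve.exists_dist_reparam_lt (γ₁ := α) (γ₂ := β.shift b₀) (by rwa [Curve.dist_def])
  have hclose : ∀ t, dist (α t) ((β.shift b₀) (φ t)) < 1 / 2 := fun t ↦
    (ContinuousMap.dist_apply_le_dist (f := α.toContinuousMap)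
      (g := ((β.shift (b₀ : ℝ)).reparam φ).toContinuousMap) t).trans_lt hφ
  have hshift : ∀ s : unitInterval, (β.shift b₀) s =
      -(((U.trans D).trans ((d.trans b).trans (a.trans c))) ⟨Int.fract ((s : ℝ) + b₀), Int.fract_nonneg _, (Int.fract_lt_one _).le⟩) := fun s ↦ by
    rw [Curve.shift_apply hβl, Curve.loopMap_coe_eq, hβ, Curve.ofPath_apply, Path.map_coe, Function.comp_apply]
  obtain ⟨tX, tY, tZ, hXY, hYZ, -, hZ1, eX, eY, eZ⟩ := marked_points hU hD ha (b := b) (c := c) (d := d)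
  -- closeness at the three marked times, moved to `L`
  have cX := hclose tX
  have cY := hclose tY
  have cZ := hclose tZ
  rw [hshift, show α tX = ((U.trans D).trans ((d.trans b).trans (a.trans c))) tX from rfl, eX, dist_eq_norm, sub_neg_eq_add, add_comm, ← sub_neg_eq_add,
    ← dist_eq_norm] at cX
  rw [hshift, show α tY = ((U.trans D).trans ((d.trans b).trans (a.trans c))) tY from rfl, eY, dist_eq_norm, sub_neg_eq_add, add_comm, ← sub_eq_add_neg,
    ← dist_eq_norm] at cY
  rw [hshift, show α tZ = ((U.trans D).trans ((d.trans b).trans (a.trans c))) tZ from rfl, eZ, dist_eq_norm,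
    show ∀ w : ℂ, -1 + I - -w = w - (1 - I) from fun w ↦ by ring, ← dist_eq_norm] at cZ
  have wX : 1 / 4 < Int.fract ((φ tX : ℝ) + b₀) ∧ Int.fract ((φ tX : ℝ) + b₀) < 1 / 2 :=
    window_neg_two_I hU hD ha hb hc hd cX
  have wY : Int.fract ((φ tY : ℝ) + b₀) < 1 / 4 := window_two_I hU hD ha hb hc hd cY
  have wZ : 1 / 2 < Int.fract ((φ tZ : ℝ) + b₀) ∧ Int.fract ((φ tZ : ℝ) + b₀) ≤ 5 / 8 :=
    window_one_sub_I hU hD ha hb hc cZ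
  -- the three shifted times are cyclically increasing: contradiction
  have hmono := φ.strictMono
  have h1 : (φ tZ : ℝ) < 1 := by
    have := hmono hZ1
    rw [show φ 1 = 1 from OrderIso.map_top φ] at this
    exact_mod_cast this
  rcases cyclic_fract (φ tX).2.1 (Subtype.coe_lt_coe.2 (hmono hXY)) (Subtype.coe_lt_coe.2 (hmono hYZ)) h1 b₀
    with ⟨e₁, e₂⟩ | ⟨e₁, e₂⟩ | ⟨e₁, e₂⟩
  · linarith [wX.1, wY]
  · linarith [wX.2, wZ.1]
  · linarith [wX.1, wY]

end Loop

end TwoMouth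

open TwoMouth

/-- **Anchor (registered): two TAME unbased loops with the same winding function which are different** — indeed
at oriented unbased distance `≥ 1/2`: the two-mouth-lake loop `L = U·D·d·b·a·c` and its rotation `−L` by `π`
(module docstring).  This refutes the registered helper `tame_rigidity`. -/
theorem exists_tame_wind_eq_ne :
    ∃ u v : UnbasedLoop ℂ, Tame u ∧ Tame v ∧ (∀ z, u.wind z = v.wind z) ∧ 1 / 2 ≤ dist u v ∧ u ≠ v := by
  obtain ⟨U, D, a, b, c, d, hU, hD, ha, hb, hc, hd⟩ := exists_arcs
  have hr := range_loop hU hD ha hb hc hd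
  have hw := wind_loop hU hD ha hb hc hd
  have h2 := atMostDouble_loop hU hD ha hb hc hd
  have hdist := half_le_dist hU hD ha hb hc hd
  refine ⟨_, _, tame_of_spec _ hr hw h2,
    tame_of_spec _ (range_neg _ hr) (wind_neg _ hw) (atMostDouble_neg _ h2), fun z ↦ ?_, hdist, fun h ↦ ?_⟩
  · change (Curve.ofPath _).wind z = (Curve.ofPath _).wind z
    rw [hw, wind_neg _ hw]
  · rw [h, dist_self] at hdist
    norm_num at hdist

/-- **`tame_rigidity` is false**: the winding function does not determine a tame unbased loop of the plane
(single-signed degree one, trace = frontier of the interior, solid, at most double points). -/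
theorem not_tame_rigidity :
    ¬ ∀ u v : UnbasedLoop ℂ, Tame u → Tame v → (∀ z, u.wind z = v.wind z) → u = v := by
  obtain ⟨u, v, hu, hv, hw, -, hne⟩ := exists_tame_wind_eq_ne
  exact fun h ↦ hne (h u v hu hv hw)

end Summit.CriticalPhenomena.CardyFormulaZ2.Cruxes.NestingRigidity.PositiveConeWeightDoubling

end
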